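import Summits.BirchSwinnertonDyer.BirchSwinnertonDyer.Theorems.ClassRecordThreeCornerTwistWitnessReplays
import Summits.BirchSwinnertonDyer.BirchSwinnertonDyer.Theorems.ClassRecordThreeCornerAtThreeUpperShimuraDefs
import HarnessLib

/-!
# Crux idea (item stmt-BirchSwinnertonDyer-21420 `ClassRecordThree.CornerAtThreeW`, conjunct (L) = `Three.CornerStepLAt`):
# the STEP-L conjunct in its CONSUMER shape — `CornerAtThreeLowerConsumed` (cell `bsd-stepL`, seat `bsd-stepL-mult-idea` g12)

PLANNER SKETCH — elaborates on the farm, `sorry`-free; NOT a proposal, NOT a Theorems file; nothing is booked.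
Card: `Cruxes/CornerAtThreeW/Ideas/stepl-consumed-shape-recut-at-3.md` (to be filed by @plan; TURNKEY T-g12-1).

## What is typed here

* §1 `CornerAtThreeLowerConsumed` — conjunct (L) of crux `CornerAtThreeW` RE-CUT to the shape its only consumer uses
  (`CornerTwistWitness.missingLowerBoundAt_of_cornerStepLAt_of_cornerTwistWitnessAt`, the lower half fed to
  `Typed.missingPPartAt_of_lower_of_upper` inside `CornerTwistWitness.missingPPartAt_of_corner_of_witness`): the FRAME-FREE
  `ℚ`-level statement `ord₃ #Ш(E)_an ≤ ord₃ #Ш(E)` on the (T4″)₃ corner. This is the (L)-analogue of RULING 40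
  (`Theorems.CornerAtThreeUpperConsumed` = conjunct (U) in consumer shape) and of RULING 33/39 (the ∃-recut of (Tw)).
  `CornerAtThreeWConsumed` = the whole crux in consumer shape: (L′) ∧ (W) ∧ (U′).
* §2 kernel: (L) ∧ (W) ⟹ (L′) class-wide (one call of the existing replayed consumer), and (L′) + an upper half ⟹ the
  corner's `Typed.MissingPPartAt W 3` (one call of `Typed.missingPPartAt_of_lower_of_upper`) — so the route kernels
  `multiplicativeRankOneAtThree_of_classRecord_upperConsumed_of_twistWitness` ∕ `…_of_kolyRecord_…` re-key from `hCL` to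
  `hCL' : CornerAtThreeLowerConsumed` by a one-token edit of `missingPPartAt_of_corner_of_witness` (lower := `hCL' W hX hns`);
  and, under the recut, the twist witness (W) is consumed ONLY on the `3 ∤ ∏c` cells (t0 = 88∕296):
  `missingPPartAt_of_lowerConsumed_of_upperConsumed_of_witnessOnT0` (the `3 ∣ ∏c` cells use (L′) + (U′) and no twin).
* §3 the OVER-ASK of (L) as typed, in valuation currency (pure arithmetic, `omega`): at an odd Heegner frame `K` with
  `L(E^{d_K},1) ≠ 0`, writing `m = ord₃[E(K):ℤP]`, `t = ord₃ ∏c(E)`, `aE ∕ aD = ord₃ #Ш_an(E) ∕ #Ш_an(E^{d_K})`,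
  `sE ∕ sD = ord₃ #Ш(E) ∕ #Ш(E^{d_K})`, the Gross–Zagier index identity `2m = aE + aD + 2t` (Manin, torsion, `u_K` are
  `3`-units on the corner frame) and `Ш(E∕K)[3^∞] = Ш(E)[3^∞] ⊕ Ш(E^{d_K})[3^∞]` turn `IndexLowerBoundAt` (= (L) at `K`, tree
  `Three.indexLowerBoundAt_of_cornerStepLAt` ∕ `imcLowerWaldspurgerOnTreeAt_of_controlOnTreeAt_of_indexLowerBoundAt_prime`)
  into the JOINT lower half `aE + aD ≤ sE + sD`; the consumer adds the twin's upper half `sD ≤ aD` (from `BSDp Wd 3`) to get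
  `aE ≤ sE`; conversely, once `BSD₃(E)` holds (`aE = sE`, the route's conclusion), (L) at `K` IS the twin's lower half
  `aD ≤ sD` — for EVERY admissible `K`, i.e. for every rank-0 odd Heegner twist: content no consumer uses.

Census reading (HOME `corner/mult-idea-g12/LENS-MEMO.md` §3): (L) quantifies over all odd Heegner frames — on the
census family of `mult-p3/census-g5` that is 8 086 rank-0 twists `|d| ≤ 3000` of the 296 corner curves, of which 1 681
are DEEP (`ord₃ #Ш_an(E^d) ∈ {2: 1 513, 4: 161, 6: 7}`) and carry a non-vacuous twin lower half; (L′) quantifies over the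
296 curves alone, and `ord₃ #Ш_an(E) = 0` on 296∕296 (b2b `census-corner3/corner3_census.tsv`: `sha_an ∈ {1: 295, 4: 1}`).

References: [Miller2011LMS] Def. 1.1; [JetchevSkinnerWan2017] §7.4.1–7.4.2 (pp. 30–31); [GrossZagier1986] I.(6.3), V.(2.2);
[KolyvaginEulerSystems1990] Cor. 13; cell board RULINGs 33 ∕ 39 ∕ 40 (HOME/STATUS.md 2026-08-27).
-/

noncomputable section

open scoped Classical

open WeierstrassCurve NumberField IsDedekindDomain Field Literature.NumberTheory.EllipticCurves
  Rat.HeightOneSpectrum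
  Literature.NumberTheory.DiophantineGeometry
  Literature.NumberTheory.EllipticCurves.GreenbergSelmer
  Literature.NumberTheory.EllipticCurves.ModularForms
  Literature.NumberTheory.EllipticCurves.Rank1Residual
  Literature.NumberTheory.EllipticCurves.Rank1Residual.Typed
  Literature.NumberTheory.EllipticCurves.Wuthrich2014
  Literature.NumberTheory.EllipticCurves.BalakrishnanEtAl2019
  Literature.NumberTheory.QuadraticFields.Quadratic
  Literature.NumberTheory.Automorphic
  Literature.NumberTheory.GaloisRepresentations Literature.NumberTheory.GaloisCohomology
  Summit.BirchSwinnertonDyer.Rank1Residual.X11b.AcSelmer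
  Summit.BirchSwinnertonDyer.Rank1Residual.X11b.LocBridge
  Summit.BirchSwinnertonDyer.Rank1Residual
  Summit.BirchSwinnertonDyer.Rank1Residual.X11b
  Summit.BirchSwinnertonDyer.Rank1Residual.X11b.Three
  Summit.BirchSwinnertonDyer.BirchSwinnertonDyer.Theorems

set_option linter.dupNamespace false

namespace Summit.BirchSwinnertonDyer.BirchSwinnertonDyer.Cruxes.CornerAtThreeW.StepLConsumedRecut

/-! ### §1. The recut statements -/

/-- **Conjunct (L) of crux `CornerAtThreeW` in its CONSUMER shape**: the frame-free `ℚ`-level lower half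
`ord₃ #Ш(E)_an ≤ ord₃ #Ш(E)` (Miller's currency, `Typed.MissingLowerBoundAt W 3`) on every corner curve
(`ClassX11b W 3 ∧ ¬ Surj W 3`). Implied by `CornerStepLAt ∧ CornerTwistWitnessAt` class-wide
(`cornerAtThreeLowerConsumed_of_cornerStepL_of_cornerTwistWitness`). A `Prop` constant; OPEN; nothing asserted.
[cite: Miller2011LMS, Def. 1.1] [cite: JetchevSkinnerWan2017, §7.4.1 (pp. 30–31) (shape)] -/
@[conjecture]
def CornerAtThreeLowerConsumed : Prop :=
  ∀ (W : WeierstrassCurve ℚ) [W.IsElliptic] [W.IsGloballyMinimal],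
    ClassX11b W 3 → ¬ Surj W 3 → Typed.MissingLowerBoundAt W 3

/-- Conjunct (W) of `CornerAtThreeW`, class-wide (verbatim the kernel binder `hCW`). -/
def CornerTwistWitnessAll : Prop :=
  ∀ (W : WeierstrassCurve ℚ) [W.IsElliptic] [W.IsGloballyMinimal], CornerTwistWitness.CornerTwistWitnessAt W

/-- **The whole crux in consumer shape**: (L′) ∧ (W) ∧ (U′). -/
def CornerAtThreeWConsumed : Prop :=
  CornerAtThreeLowerConsumed ∧ CornerTwistWitnessAll ∧ Theorems.CornerAtThreeUpperConsumed

/-! ### §2. Kernel: the recut is implied by the crux as typed, and feeds the same consumer -/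

/-- **(L) ∧ (W) ⟹ (L′)** class-wide: one call of the existing replayed consumer
`CornerTwistWitness.missingLowerBoundAt_of_cornerStepLAt_of_cornerTwistWitnessAt` (same PUBLISHED binders). -/
theorem cornerAtThreeLowerConsumed_of_cornerStepL_of_cornerTwistWitness
    (hGZ : ∀ (N : ℕ) [NeZero N] (W : WeierstrassCurve ℚ) (K : Type) [Field K] [NumberField K],
      gross_zagier N W K)
    (hKo : ∀ (N : ℕ) [NeZero N] (W : WeierstrassCurve ℚ) (K : Type) [Field K] [NumberField K],
      kolyvagin N W K)
    (hGZK : rank_eq_analyticRank_of_analyticRank_le_one) (hmod : hasEntireLFunction_rat)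
    (hnf : exists_isNewformOf) (hMaz : mazur_not_dvd_maninConstant_of_odd)
    (hPT : ∀ (K : Type) [Field K] [NumberField K], poitouTate_sum_localTatePairing_eq_zero K)
    (hEP : ∀ (K : Type) [Field K] [NumberField K] (v : HeightOneSpectrum (𝓞 K)),
      localEulerPoincareCharacteristic (v.adicCompletion K))
    (hCL : ∀ (W : WeierstrassCurve ℚ) [W.IsElliptic] [W.IsGloballyMinimal], CornerStepLAt W)
    (hCW : CornerTwistWitnessAll) :
    CornerAtThreeLowerConsumed := by
  haveI : Fact (Nat.Prime 3) := ⟨Nat.prime_three⟩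
  intro W _ _ hX hns
  exact CornerTwistWitness.missingLowerBoundAt_of_cornerStepLAt_of_cornerTwistWitnessAt hGZ hKo hGZK hmod hnf
    hMaz hPT hEP W hX hns (hCL W) (hCW W)

/-- **(L′) feeds the corner's `p`-part exactly where (L) did**: with any upper half at the pair, the whole missing
output `Typed.MissingPPartAt W 3` (the argument of `Typed.bsdp_of_missingPPartAt` in both route kernels). The upper
half is supplied today by `Theorems.CornerAtThreeUpperConsumed` on `3 ∣ ∏c` and by Matar–Nekovář + the witness's
`≥`-half on `3 ∤ ∏c` (`CornerTwistWitness.missingPPartAt_of_corner_of_witness`, upper branch, unchanged). -/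
theorem missingPPartAt_of_lowerConsumed_of_upper (hL : CornerAtThreeLowerConsumed)
    (W : WeierstrassCurve ℚ) [W.IsElliptic] [W.IsGloballyMinimal] (hX : ClassX11b W 3) (hns : ¬ Surj W 3)
    (hU : Typed.MissingUpperBoundAt W 3) : Typed.MissingPPartAt W 3 :=
  Typed.missingPPartAt_of_lower_of_upper W 3 (hL W hX hns) hU

/-- The `3 ∣ ∏c` cells: (L′) ∧ (U′) already give the corner's `p`-part with NO twist witness. -/
theorem missingPPartAt_of_lowerConsumed_of_upperConsumed (hL : CornerAtThreeLowerConsumed)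
    (hU : Theorems.CornerAtThreeUpperConsumed)
    (W : WeierstrassCurve ℚ) [W.IsElliptic] [W.IsGloballyMinimal] (hX : ClassX11b W 3) (hns : ¬ Surj W 3)
    (ht : 3 ∣ W.tamagawaProduct) : Typed.MissingPPartAt W 3 :=
  Typed.missingPPartAt_of_lower_of_upper W 3 (hL W hX hns) (hU W hX hns ht)

/-- **The corner's `p`-part RE-KEYED to (L′)** — replay of `CornerTwistWitness.missingPPartAt_of_corner_of_witness` with the
binder `hSL : CornerStepLAt W` replaced by `hL : CornerAtThreeLowerConsumed` (the lower half is now `hL W hX hns`; the upper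
branch — (U♯) on `3 ∣ ∏c`, Matar–Nekovář + the witness's `≥`-half on `3 ∤ ∏c` — is VERBATIM the tree's). This is the one
place either route kernel (`multiplicativeRankOneAtThree_of_classRecord_upperConsumed_of_twistWitness` ∕ `…_of_kolyRecord_…`,
corner branch) touches conjunct (L); so `closes` re-keys from `h₅ : CornerAtThreeW` to (L′) ∧ (W) ∧ (U′) by swapping this call.
Same PUBLISHED binders as the tree theorem; CONDITIONAL on `hL`, `hWit`, `hU`; nothing booked.
-- adapted from Summits/BirchSwinnertonDyer/BirchSwinnertonDyer/Theorems/ClassRecordThreeCornerTwistWitnessReplays.lean (l. 198)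
[cite: MatarNekovar2019, Thm. 0.3 (JTNB 31 (2019) pp. 456–457)] [cite: JetchevSkinnerWan2017, §7.4.1–7.4.2 (pp. 30–31)]
[cite: Miller2011LMS, Def. 1.1] -/
theorem missingPPartAt_of_lowerConsumed_of_witness [Fact (Nat.Prime 3)]
    (hGZ : ∀ (N : ℕ) [NeZero N] (W : WeierstrassCurve ℚ) (K : Type) [Field K] [NumberField K],
      gross_zagier N W K)
    (hKo : ∀ (N : ℕ) [NeZero N] (W : WeierstrassCurve ℚ) (K : Type) [Field K] [NumberField K],
      kolyvagin N W K)
    (hGZK : rank_eq_analyticRank_of_analyticRank_le_one) (hmod : hasEntireLFunction_rat)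
    (hnf : exists_isNewformOf) (hMaz : mazur_not_dvd_maninConstant_of_odd)
    (hMN : ∀ (N : ℕ) [NeZero N] (W : WeierstrassCurve ℚ) (K : Type) [Field K] [NumberField K],
      MatarNekovar2019.thm03_padicValNat_card_sha_le_of_irreducible N W K)
    (W : WeierstrassCurve ℚ) [W.IsElliptic] [W.IsGloballyMinimal] (hX : ClassX11b W 3)
    (hns : ¬ Surj W 3)
    -- (L′) the lower half in CONSUMER shape — NO source at `3`
    (hL : CornerAtThreeLowerConsumed)
    -- (Tw∃) ONE odd Heegner twin with `BSD(E^{d_K},3)` — NO source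
    (hWit : CornerTwistWitness.CornerTwistWitnessAt W)
    -- (U♯) the Euler-system half when `3 ∣ ∏c(E)`
    (hU : 3 ∣ W.tamagawaProduct → Typed.MissingUpperBoundAt W 3) :
    Typed.MissingPPartAt W 3 := by
  refine Typed.missingPPartAt_of_lower_of_upper W 3 (hL W hX hns) ?_
  by_cases ht : 3 ∣ W.tamagawaProduct
  · exact hU ht
  · -- `3 ∤ ∏c`: Matar–Nekovář + the twin's `≥`-half, at the WITNESS field (verbatim the tree's upper branch)
    have hNS : integral_neronScaling_of_isGloballyMinimal :=
      integral_neronScaling_of_isGloballyMinimal_holds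
    obtain ⟨hr, hp2, hmult, hirr⟩ := id hX
    haveI : NeZero (W.conductorNorm ℤ) := ⟨(W.conductorNorm_pos_holds).ne'⟩
    obtain ⟨K, _, _, Wd, _, _, Cd, hK, hodd, hlt, hHN, hH3, hLt, hWd, hbsd⟩ := hWit hX hns
    have hpd : ¬ (3 : ℤ) ∣ NumberField.discr K := not_dvd_discr_of_split hK Nat.prime_three hp2 hH3
    have hμ : ¬ 3 ∣ Units.torsionOrder K := by
      haveI : IsTotallyComplex K := hK.2
      rw [Literature.NumberTheory.DiophantineGeometry.torsionOrder_eq_two_of_discr_lt hK.1 hlt]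
      omega
    obtain ⟨Dt, H, ι, P, hP, hc⟩ :=
      exists_maninDatum_of_odd hnf hMaz hNS W 3 (W.conductorNorm ℤ) K rfl hp2 hmult hirr hK hHN
    have htam : padicValNat 3 Wd.tamagawaProduct = padicValNat 3 W.tamagawaProduct :=
      X2.padicValNat_tamagawaProduct_twist_of_heegner_of_odd W 3 hp2 K hK hodd hpd hHN Cd hWd
    have hu : padicValRat 3 (Cd.u : ℚ) = 0 :=
      padicValRat_u_eq_zero_of_twist_minimal W 3 K hK hHN hmult Cd hWd
    have hD0 : (NumberField.discr K : ℚ) ≠ 0 := by exact_mod_cast NumberField.discr_ne_zero K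
    haveI hEt : (W.quadraticTwist (NumberField.discr K : ℚ)).IsElliptic := W.isElliptic_quadraticTwist hD0
    have hLt' : (W.quadraticTwist (NumberField.discr K : ℚ)).entireLFunction = Wd.entireLFunction := by
      rw [← hWd, entireLFunction_smul]
    have hLd1 : Wd.entireLFunction 1 ≠ 0 := by rw [← hLt']; exact hLt
    have hrd : Wd.analyticRank = 0 := (Wd.analyticRank_eq_zero_iff_holds (hmod Wd)).2 hLd1
    obtain ⟨qd, hqd, hvqd⟩ := exists_LOne_div_realPeriodRat_of_bsdp_rankZero hGZK hmod Wd 3 hrd hbsd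
    have hD3 : NumberField.discr K ≠ -3 := by omega
    have hD4 : NumberField.discr K ≠ -4 := by omega
    exact missingUpperBoundAt_of_shaIndexBound W 3 (W.conductorNorm ℤ) K Dt H ι P (hGZ _ W K)
      (hKo _ W K) hGZK hmod hK hHN hP hp2 hc hμ hr hLt Wd Cd hWd hu htam ht ⟨qd, hqd, hvqd.le⟩
      (fun _ hnt ↦ hMN _ W K hK hHN hD3 hD4 ⟨Dt, H, ι, hP⟩ hnt Nat.prime_three (by decide) hirr)

/-- **Under the recut, the twist witness (W) is load-bearing only on the `3 ∤ ∏c` cells** (census: t0 = 88∕296):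
(L′) + (U′) + a witness supplied ONLY when `3 ∤ ∏c(E)` give the corner's `p`-part at every corner pair. With (L) at
frame strength the witness is needed on all cells (it hosts (L)); here the `3 ∣ ∏c` cells (208∕296) use no twin at all. -/
theorem missingPPartAt_of_lowerConsumed_of_upperConsumed_of_witnessOnT0 [Fact (Nat.Prime 3)]
    (hGZ : ∀ (N : ℕ) [NeZero N] (W : WeierstrassCurve ℚ) (K : Type) [Field K] [NumberField K],
      gross_zagier N W K)
    (hKo : ∀ (N : ℕ) [NeZero N] (W : WeierstrassCurve ℚ) (K : Type) [Field K] [NumberField K],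
      kolyvagin N W K)
    (hGZK : rank_eq_analyticRank_of_analyticRank_le_one) (hmod : hasEntireLFunction_rat)
    (hnf : exists_isNewformOf) (hMaz : mazur_not_dvd_maninConstant_of_odd)
    (hMN : ∀ (N : ℕ) [NeZero N] (W : WeierstrassCurve ℚ) (K : Type) [Field K] [NumberField K],
      MatarNekovar2019.thm03_padicValNat_card_sha_le_of_irreducible N W K)
    (hL : CornerAtThreeLowerConsumed) (hU : Theorems.CornerAtThreeUpperConsumed)
    (W : WeierstrassCurve ℚ) [W.IsElliptic] [W.IsGloballyMinimal] (hX : ClassX11b W 3) (hns : ¬ Surj W 3)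
    -- (Tw∃) demanded ONLY off the Tamagawa-3 locus
    (hWit : ¬ 3 ∣ W.tamagawaProduct → CornerTwistWitness.CornerTwistWitnessAt W) :
    Typed.MissingPPartAt W 3 := by
  by_cases ht : 3 ∣ W.tamagawaProduct
  · exact missingPPartAt_of_lowerConsumed_of_upperConsumed hL hU W hX hns ht
  · exact missingPPartAt_of_lowerConsumed_of_witness hGZ hKo hGZK hmod hnf hMaz hMN W hX hns hL (hWit ht)
      (fun ht' ↦ absurd ht' ht)

/-- A vacuous-in-value instance: where `#Ш(E)_an` is a rational `3`-adic unit-or-better (`ord₃ q ≤ 0`; census: `q = 1`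
on 295∕296 corner pairs, `q = 4` on 1), the lower half holds with nothing to construct. Bookkeeping (`padicValNat ≥ 0`). -/
theorem missingLowerBoundAt_of_shaAn_val_nonpos (W : WeierstrassCurve ℚ) (q : ℚ) (hq : shaAn W = (q : ℂ))
    (hv : padicValRat 3 q ≤ 0) : Typed.MissingLowerBoundAt W 3 :=
  ⟨q, hq, hv.trans (by exact_mod_cast Nat.zero_le _)⟩

/-! ### §3. The over-ask of (L) as typed, in valuation currency -/

/-- At a frame: given the Gross–Zagier index identity `2m = aE + aD + 2t`, the index lower bound
`2m ≤ (sE + sD) + 2t` (= (L) at `K`, with `ord₃ #Ш(E∕K) = sE + sD`) is EXACTLY the joint lower half. -/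
theorem indexLowerBound_iff_jointLower (m t aE aD sE sD : ℕ) (hGZ : 2 * m = aE + aD + 2 * t) :
    2 * m ≤ (sE + sD) + 2 * t ↔ aE + aD ≤ sE + sD := by omega

/-- What the consumer does: (L) at `K` + the twin's UPPER half `sD ≤ aD` ⟹ the curve's lower half `aE ≤ sE`. -/
theorem lowerE_of_indexLowerBound_of_upperTwin (m t aE aD sE sD : ℕ) (hGZ : 2 * m = aE + aD + 2 * t)
    (hILB : 2 * m ≤ (sE + sD) + 2 * t) (hUD : sD ≤ aD) : aE ≤ sE := by omega

/-- What nobody consumes: (L) at `K` + the curve's UPPER half `sE ≤ aE` (a fortiori `BSD₃(E)`, the route's conclusion)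
⟹ the TWIN's lower half `aD ≤ sD` — one rank-0 small-image lower half per admissible frame. -/
theorem lowerTwin_of_indexLowerBound_of_upperE (m t aE aD sE sD : ℕ) (hGZ : 2 * m = aE + aD + 2 * t)
    (hILB : 2 * m ≤ (sE + sD) + 2 * t) (hUE : sE ≤ aE) : aD ≤ sD := by omega

/-- Conversely the two `ℚ`-level lower halves give (L) at the frame: (L′) for `E` and (L′) for the twin re-assemble (L). -/
theorem indexLowerBound_of_lowerE_of_lowerTwin (m t aE aD sE sD : ℕ) (hGZ : 2 * m = aE + aD + 2 * t)
    (hLE : aE ≤ sE) (hLD : aD ≤ sD) : 2 * m ≤ (sE + sD) + 2 * t := by omega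

/-- The shallow frames cost nothing: `m ≤ t` gives (L) at `K` outright (tree: `Three.indexLowerBoundAt_of_not_dvd_index`,
`Theorems.indexLowerBoundAt_of_index_le_tamagawa`); by the identity this is the locus `aE = aD = 0`. -/
theorem indexLowerBound_of_shallow (m t sE sD : ℕ) (h : m ≤ t) : 2 * m ≤ (sE + sD) + 2 * t := by omega

end Summit.BirchSwinnertonDyer.BirchSwinnertonDyer.Cruxes.CornerAtThreeW.StepLConsumedRecut
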